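import Summits.BirchSwinnertonDyer.BirchSwinnertonDyer.Theorems.PrintCf2SplitBadTwoRestrictedSelmerLocalKummerCyclic
import Summits.BirchSwinnertonDyer.BirchSwinnertonDyer.Theorems.PrintCf2SplitBadTwoLocalCyclicOfFrame
import HarnessLib

/-!
# Crux `PrintCf2.SplitBadTwoRankOneOfFacts` (stmt-BirchSwinnertonDyer-20368), road α v10.3, S3c bottom value:
# THE BOTTOM VALUE (R-BV) OF S3c ⟸ (F1) ∧ (F3) — both local CM inputs (H1′), (H2) of `rBV_of_three_factor_values` are theorems

Cell `bsd-print-cf2`, width seat `bsd-line-cf2-p1-w7` g3 (file 7 of the seat; -w7 g2's bottom-value lane, memo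
`Cruxes/SplitBadTwoRankOneOfFacts/BOTTOM-VALUE-SNAKE-w7g2-v2.md` §2); `--supports stmt-BirchSwinnertonDyer-20368` (helper, Theses-free). HONEST FRAMING:
nothing here closes a crux or a stub; BSD is not proved by any of this; no summit statement is proved by this seat. No definition, no named fact,
no `sorry`, no kit. beyond-print theorem: no.

WHAT. **`rBV_of_F1_F3`** — (R-BV) of LEAD g12's S3c assembly ⟸ (F1) ∧ (F3) ONLY: -w3 g9's `CMPrimes.rBV_of_factor_values`
(`…LocalCyclicOfFrame`, ⟸ (F1) ∧ (F3) ∧ (H2); it decides the CM inputs (H1′) = `CMPrimes.hH1_holds`, (H1-Sel), (T-loc-cl) by the finiteness of the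
conjugate restricted group and `E(K_v) ⊇ ℤ₂`) with its last displayed local input (H2) := `bottom_exhaustion_at_vbar` (this seat,
`…RestrictedSelmerLocalKummerCyclic`, p680982). ((H1′) VERBATIM is already the tree's `CMPrimes.hH1_holds`; not restated.)
WHAT IS LEFT of the bottom value: (F1) the local index of `P` at `v̄` (`ℓ + 2 − t([d]₂)`, -w6 g3) and (F3) the Poitou–Tate term.

References: [Agboola2007] §6 Props. 6.10–6.11, §8 Prop. 8.1; [GreenbergLNM1716] §2; [Rubin1999] §3 Lemma 3.6 (ii); [SilvermanAEC2009] VII.6.3.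
-/

noncomputable section

open scoped Classical TensorProduct

set_option linter.dupNamespace false -- `Summit.BirchSwinnertonDyer.BirchSwinnertonDyer` (summit = problem) is the tree's layout
set_option autoImplicit false

open NumberField IsDedekindDomain Field WeierstrassCurve
open Literature.NumberTheory.EllipticCurves Literature.NumberTheory.EllipticCurves.GreenbergSelmer
open Literature.NumberTheory.EllipticCurves.Castella2018.AcSelmer
open Literature.NumberTheory.EllipticCurves.Agboola2007
open Literature.NumberTheory.EllipticCurves.ResKernel
open Literature.NumberTheory.GaloisRepresentations

universe u

namespace Summit.BirchSwinnertonDyer.BirchSwinnertonDyer.Theorems.PrintCf2.RestrictedSelmerPair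

/-! ## (R-BV) from (F1) and (F3) alone -/

section RBV

/-- **(R-BV) OF LEAD g12's S3c ASSEMBLY ⟸ (F1) ∧ (F3) ONLY.** -w3 g9's `CMPrimes.rBV_of_factor_values` (`…LocalCyclicOfFrame`: ⟸ (F1), (F3), (H2);
the CM inputs (H1′)/(H1-Sel)/(F2) decided by the finiteness of the conjugate restricted group, (T-loc-cl) by `E(K_v) ⊇ ℤ₂`) with its LAST local
input (H2) := `bottom_exhaustion_at_vbar` (this seat). What remains displayed for the bottom value: (F1) the local index of `P` at `v̄` [-w6 g3]
and (F3) the Poitou–Tate term [PT lane]. [cite: Agboola2007, Props. 6.10, 6.11, 8.1 (arXiv p0014–p0017)] [cite: GreenbergLNM1716, §2] -/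
theorem rBV_of_F1_F3
    (hF1 : ∃ e₁ : ℤ → ℤ → ℤ, ∀ (d : ℤ), d ≠ 0 → Squarefree d → d % 4 ≠ 1 →
      ∀ (W : WeierstrassCurve ℚ) [W.IsElliptic] [W.IsGloballyMinimal] (C : WeierstrassCurve.VariableChange ℚ),
        C • W = cm7.quadraticTwist (d : ℚ) → W.analyticRank = 1 →
      ∀ (K : Type) [Field K] [NumberField K], IsImaginaryQuadratic K →
      ∀ (v vbar : HeightOneSpectrum (𝓞 K)),
        ((2 : ℕ) : 𝓞 K) ∈ v.asIdeal → ((2 : ℕ) : 𝓞 K) ∈ vbar.asIdeal → vbar ≠ v →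
      ∀ (π : (W.baseChange K).endRing), (π : AddMonoid.End (W.baseChange K).geomPoints) * π = π - 2 →
      ∀ (r : ℤ_[2]), r * r = r - 2 →
        (∀ τ ∈ GreenbergSelmer.inertia v, ∀ x : ↥((W.baseChange K).endEigenPrimaryTorsion 2 π r), τ • x = x ∨ τ • x = -x) →
      ∀ (P : W.toAffine.Point) (c₀ : ℕ) (ℓ : ℤ),
        ¬ IsOfFinAddOrder P →
        (∀ R : W.toAffine.Point, ∃ (k : ℤ) (T : W.toAffine.Point), IsOfFinAddOrder T ∧ R = k • P + T) →
        c₀ ≠ 0 → (W.baseChange ℚ_[2]).IsInReductionKernel (c₀ • W.toPadicPoint 2 P) →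
        ‖(W.baseChange ℚ_[2]).padicLogPoint (c₀ • W.toPadicPoint 2 P) / (c₀ : ℚ_[2])‖ = (2 : ℝ) ^ (-ℓ) →
      Finite (restrictedSelmerBase ↥((W.baseChange K).endEigenPrimaryTorsion 2 π r) 2 vbar) →
        (padicValNat 2 (Nat.card ↥(((((W.baseChange K).kummerMapPInfty 2 (W.baseChange K).zsmul_geomPoints_surjective_holds).range).map
            (resSubgroup ⊤ ((W.baseChange K).geomPrimaryTorsion 2))).comap
          (resH1Hom (ContinuousMonoidHom.id _) ((W.baseChange K).endEigenPrimaryTorsion 2 π r).subtype (fun _ _ ↦ rfl)) ⊓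
          (resOfLe ↥((W.baseChange K).endEigenPrimaryTorsion 2 π r) (inf_le_left : ⊤ ⊓ decomp vbar ≤ ⊤)).ker)) : ℤ) = ℓ + e₁ (d % 2) ((d / (2 - d % 2)) % 8))
    (hF3 : ∃ e₃ : ℤ → ℤ → ℤ, ∀ (d : ℤ), d ≠ 0 → Squarefree d → d % 4 ≠ 1 →
      ∀ (W : WeierstrassCurve ℚ) [W.IsElliptic] [W.IsGloballyMinimal] (C : WeierstrassCurve.VariableChange ℚ),
        C • W = cm7.quadraticTwist (d : ℚ) → W.analyticRank = 1 →
      ∀ (K : Type) [Field K] [NumberField K], IsImaginaryQuadratic K →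
      ∀ (v vbar : HeightOneSpectrum (𝓞 K)),
        ((2 : ℕ) : 𝓞 K) ∈ v.asIdeal → ((2 : ℕ) : 𝓞 K) ∈ vbar.asIdeal → vbar ≠ v →
      ∀ (π : (W.baseChange K).endRing), (π : AddMonoid.End (W.baseChange K).geomPoints) * π = π - 2 →
      ∀ (r : ℤ_[2]), r * r = r - 2 →
        (∀ τ ∈ GreenbergSelmer.inertia v, ∀ x : ↥((W.baseChange K).endEigenPrimaryTorsion 2 π r), τ • x = x ∨ τ • x = -x) →
      ∀ (P : W.toAffine.Point) (c₀ : ℕ) (ℓ : ℤ),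
        ¬ IsOfFinAddOrder P →
        (∀ R : W.toAffine.Point, ∃ (k : ℤ) (T : W.toAffine.Point), IsOfFinAddOrder T ∧ R = k • P + T) →
        c₀ ≠ 0 → (W.baseChange ℚ_[2]).IsInReductionKernel (c₀ • W.toPadicPoint 2 P) →
        ‖(W.baseChange ℚ_[2]).padicLogPoint (c₀ • W.toPadicPoint 2 P) / (c₀ : ℚ_[2])‖ = (2 : ℝ) ^ (-ℓ) →
      Finite (restrictedSelmerBase ↥((W.baseChange K).endEigenPrimaryTorsion 2 π r) 2 vbar) →
        (padicValNat 2 (Nat.card ((resOfLe ↥((W.baseChange K).endEigenPrimaryTorsion 2 π r) (inf_le_left : ⊤ ⊓ decomp v ≤ ⊤)).comp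
          (restrictedSelmerBase ↥((W.baseChange K).endEigenPrimaryTorsion 2 π r) 2 vbar).subtype).range) : ℤ) = ℓ + e₃ (d % 2) ((d / (2 - d % 2)) % 8)) :
    ∃ eK : ℤ → ℤ → ℤ, ∀ (d : ℤ), d ≠ 0 → Squarefree d → d % 4 ≠ 1 →
      ∀ (W : WeierstrassCurve ℚ) [W.IsElliptic] [W.IsGloballyMinimal] (C : WeierstrassCurve.VariableChange ℚ),
        C • W = cm7.quadraticTwist (d : ℚ) → W.analyticRank = 1 →
      ∀ (K : Type) [Field K] [NumberField K], IsImaginaryQuadratic K →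
      ∀ (v vbar : HeightOneSpectrum (𝓞 K)),
        ((2 : ℕ) : 𝓞 K) ∈ v.asIdeal → ((2 : ℕ) : 𝓞 K) ∈ vbar.asIdeal → vbar ≠ v →
      ∀ (π : (W.baseChange K).endRing), (π : AddMonoid.End (W.baseChange K).geomPoints) * π = π - 2 →
      ∀ (r : ℤ_[2]), r * r = r - 2 →
        (∀ τ ∈ GreenbergSelmer.inertia v, ∀ x : ↥((W.baseChange K).endEigenPrimaryTorsion 2 π r), τ • x = x ∨ τ • x = -x) →
      ∀ (P : W.toAffine.Point) (c₀ : ℕ) (ℓ : ℤ),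
        ¬ IsOfFinAddOrder P →
        (∀ R : W.toAffine.Point, ∃ (k : ℤ) (T : W.toAffine.Point), IsOfFinAddOrder T ∧ R = k • P + T) →
        c₀ ≠ 0 → (W.baseChange ℚ_[2]).IsInReductionKernel (c₀ • W.toPadicPoint 2 P) →
        ‖(W.baseChange ℚ_[2]).padicLogPoint (c₀ • W.toPadicPoint 2 P) / (c₀ : ℚ_[2])‖ = (2 : ℝ) ^ (-ℓ) →
      Finite (restrictedSelmerBase ↥((W.baseChange K).endEigenPrimaryTorsion 2 π r) 2 vbar) →
        (padicValNat 2 (Nat.card (restrictedSelmerBase ↥((W.baseChange K).endEigenPrimaryTorsion 2 π r) 2 vbar)) : ℤ) =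
          (padicValNat 2 (Nat.card (AddCommGroup.primaryComponent W.sha 2)) : ℤ) + 2 * ℓ + eK (d % 2) ((d / (2 - d % 2)) % 8) :=
  CMPrimes.rBV_of_factor_values hF1 hF3 bottom_exhaustion_at_vbar

end RBV

end Summit.BirchSwinnertonDyer.BirchSwinnertonDyer.Theorems.PrintCf2.RestrictedSelmerPair

end
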